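import Literature.Barriers.MatrixMultiplication.IrreversibilityBarrier
import Literature.Computability.AlgebraicComplexity.MonomialRestrictionProducts
import Literature.Computability.AlgebraicComplexity.RelativeExponentTriangle
import Literature.Computability.AlgebraicComplexity.MatMulMonomialSubrankAsymptotics
import HarnessLib

/-!
# Proof of CVZ Thm. 14 (monomial irreversibility barrier with Schönhage structure) — `CVZ2021_thm14_holds`

Topic `Literature/Barriers/MatrixMultiplication`; DISCHARGE of the named fact `CVZ2021_thm14` of
`IrreversibilityBarrier.lean`: M. Christandl, P. Vrana, J. Zuiddam, *Barriers for fast matrix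
multiplication from irreversibility*, Theory of Computing 17 (2021), art. 2 = arXiv:1812.06952,
Thm. 14 (arXiv numbering, §3.3 p. 8): for every tensor `t` and `α, β ∈ ℕ`,
`(ω(⟨2⟩,t) ω_M(t, ⟨2⟩^{⊗α} ⊗ ⟨2,2,2⟩^{⊗β}) − α)/β ≥ 2 i_M(t) + (α/β)(i_M(t) − 1)`,
as vendored (`β > 0`, Assumption 1, and the finiteness hypothesis `∃ m, t^{⊗m} ≥_M ⟨2,2,2⟩`).
Everything here is PROVED; the main theorem is `CVZ2021_thm14_holds`.

## Proof (CVZ §3.3: "the proofs in the previous sections can be directly adapted", i.e. the proof of Thm. 10, p. 7, with `≥_M`)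

Write `U = ⟨2⟩`, `M = ⟨2,2,2⟩`, `s = U^{⊗α} ⊗ M^{⊗β}`, `x = ω(U,t)`, `y = ω_M(t,U)`,
`z = ω_M(t,s)`, so `i_M(t) = x y`.
* Triangle inequality for `ω_M` (CVZ Prop. 7; the tree's `monRelativeExponent_triangle`,
  `RelativeExponentTriangle.lean`): `y ≤ z · ω_M(s,U)`. Its finiteness hypotheses hold: from
  `t^{⊗m₀} ≥_M M ≥_M U` one gets `t^{⊗(αm₀+βm₀)} ≥_M s` (products of monomial restrictions,
  `MonomialRestrictionProducts.lean`), and `s ≥_M U^{⊗(α+β)} ≥_M U`.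
* `ω_M(s, U) ≤ 1/(α + 2β)` (`monRelativeExponent_schoenhageTarget_unit_le`; CVZ p. 7 use the value
  `ω(⟨2⟩^α⟨2,2,2⟩^β, ⟨2⟩) = 1/(α+2β)`): `s^{⊗k} ≥_M U^{⊗kα} ⊗ M^{⊗kβ} ≥_M U^{⊗(kα + r)}` with
  `r ≥ (2−ε)kβ` for large `k`, by the Ruzsa–Szemerédi/Behrend bound
  `exists_tensorMonRestrictsTo_kroneckerPow_matMulTensor_unitTensor`
  (`MatMulMonomialSubrankAsymptotics.lean`, the monomial-restriction form of
  `ω_M(⟨2,2,2⟩,⟨2⟩) = 1/2`, CVZ §2.4); hence `ω_M(s,U)(α + (2−ε)β) ≤ 1` for every `ε ∈ (0,1]`.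
* So `(α+2β) y ≤ z`, `(α+2β) x y ≤ x z` (`x ≥ 0`), i.e. `((α+2β) i_M(t) − α)/β ≤ (x z − α)/β`,
  which is the printed `2 i_M(t) + (α/β)(i_M(t) − 1) ≤ (x z − α)/β`.
Assumption 1 (`t` not a triad) is not used beyond what the finiteness hypothesis provides.

## References

* M. Christandl, P. Vrana, J. Zuiddam, ToC 17 (2021), art. 2 = arXiv:1812.06952, §2.4, Prop. 7,
  Thm. 10 (proof, p. 7), Thm. 14 (p. 8). [ChristandlVranaZuiddam2021]
-/

noncomputable section

open scoped BigOperators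

namespace Literature.Barriers.MatrixMultiplication

open Literature.Computability.AlgebraicComplexity

universe u

/-! ## The Schönhage target `⟨2⟩^{⊗α} ⊗ ⟨2,2,2⟩^{⊗β}` -/

section SchoenhageTarget

variable (K : Type u) [CommSemiring K]

/-- `⟨2⟩^{⊗α} ⊗ ⟨2,2,2⟩^{⊗β} ≥_M ⟨2⟩` whenever `α + β ≥ 1`
(`≥_M ⟨2⟩^{⊗α} ⊗ ⟨2⟩^{⊗β} ≥_M ⟨2⟩^{⊗(α+β)} ≥_M ⟨2^{α+β}⟩ ≥_M ⟨2⟩`): the finiteness hypothesis of the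
triangle inequality through the Schönhage target. [cite: ChristandlVranaZuiddam2021, §3.3] -/
theorem unitPow_kronecker_matMulPow_monRestrictsTo_unitTensor (α β : ℕ) (h : 1 ≤ α + β) :
    TensorMonRestrictsTo
      (kroneckerTensor (kroneckerPow (unitTensor K 2) α) (kroneckerPow (matMulTensor K 2 2 2) β))
      (unitTensor K 2) := by
  classical
  have hM : TensorMonRestrictsTo (matMulTensor K 2 2 2) (unitTensor K 2) :=
    tensorMonRestrictsTo_matMulTensor_unitTensor_diag K 2
  refine (((TensorMonRestrictsTo.refl _).kronecker (hM.kroneckerPow β)).trans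
    (tensorMonRestrictsTo_kroneckerPow_add' (unitTensor K 2) α β)).trans ?_
  exact (tensorMonRestrictsTo_pow_unitTensor (K := K) 2 (α + β)).trans
    (tensorMonRestrictsTo_unitTensor_castLE (K := K) (Nat.le_self_pow (by omega) 2))

/-- One witness for the Schönhage target: from `⟨2,2,2⟩^{⊗(kβ)} ≥_M ⟨2⟩^{⊗r}`,
`(⟨2⟩^{⊗α} ⊗ ⟨2,2,2⟩^{⊗β})^{⊗k} ≥_M ⟨2⟩^{⊗(kα + r)}`
(`≥_M ⟨2⟩^{⊗kα} ⊗ ⟨2,2,2⟩^{⊗kβ} ≥_M ⟨2⟩^{⊗kα} ⊗ ⟨2⟩^{⊗r} ≥_M ⟨2⟩^{⊗(kα+r)}`).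
[cite: ChristandlVranaZuiddam2021, Thm. 10 (proof)] -/
theorem schoenhageTarget_pow_monRestrictsTo_unitPow {α β k r : ℕ}
    (h : TensorMonRestrictsTo (kroneckerPow (matMulTensor K 2 2 2) (k * β))
      (kroneckerPow (unitTensor K 2) r)) :
    TensorMonRestrictsTo
      (kroneckerPow (kroneckerTensor (kroneckerPow (unitTensor K 2) α)
        (kroneckerPow (matMulTensor K 2 2 2) β)) k)
      (kroneckerPow (unitTensor K 2) (k * α + r)) := by
  classical
  refine (tensorMonRestrictsTo_kroneckerPow_kronecker _ _ k).trans ?_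
  refine (((tensorMonRestrictsTo_kroneckerPow_mul' (unitTensor K 2) k α).kronecker
    ((tensorMonRestrictsTo_kroneckerPow_mul' (matMulTensor K 2 2 2) k β).trans h))).trans ?_
  exact tensorMonRestrictsTo_kroneckerPow_add' (unitTensor K 2) (k * α) r

/-- **`ω_M(⟨2⟩^{⊗α} ⊗ ⟨2,2,2⟩^{⊗β}, ⟨2⟩) ≤ 1/(α + 2β)`** for `β ≥ 1` — the value
`ω(⟨2⟩^α⟨2,2,2⟩^β, ⟨2⟩) = 1/(α+2β)` used in the proof of CVZ Thm. 10/14 (p. 7: "`= (α + 2β) i(t)`"),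
here the inequality needed, for monomial restriction, from the Ruzsa–Szemerédi/Behrend witnesses
`⟨2,2,2⟩^{⊗L} ≥_M ⟨2⟩^{⊗r}`, `r ≥ (2−ε)L`: for every `ε ∈ (0,1]`,
`ω_M(s,⟨2⟩) · (α + (2−ε)β) ≤ 1`, and `ε → 0`. [cite: ChristandlVranaZuiddam2021, Thm. 10 (proof)] -/
theorem monRelativeExponent_schoenhageTarget_unit_le (α β : ℕ) (hβ : 0 < β) :
    monRelativeExponent
        (kroneckerTensor (kroneckerPow (unitTensor K 2) α) (kroneckerPow (matMulTensor K 2 2 2) β))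
        (unitTensor K 2) ≤ 1 / ((α : ℝ) + 2 * β) := by
  set w : ℝ := monRelativeExponent
    (kroneckerTensor (kroneckerPow (unitTensor K 2) α) (kroneckerPow (matMulTensor K 2 2 2) β))
    (unitTensor K 2)
  have hw0 : 0 ≤ w := monRelativeExponent_nonneg _ _
  -- Step 1: for every `ε ∈ (0,1]`, `w (α + (2-ε) β) ≤ 1`.
  have step : ∀ ε : ℝ, 0 < ε → ε ≤ 1 → w * ((α : ℝ) + (2 - ε) * β) ≤ 1 := by
    intro ε hε hε1
    obtain ⟨L₀, hL₀⟩ :=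
      exists_tensorMonRestrictsTo_kroneckerPow_matMulTensor_unitTensor K hε hε1
    obtain ⟨r, hr, hMU⟩ :=
      hL₀ ((L₀ + 1) * β) ((Nat.le_succ L₀).trans (Nat.le_mul_of_pos_right _ hβ))
    have w1 := schoenhageTarget_pow_monRestrictsTo_unitPow K (α := α) hMU
    -- the exponent `(L₀+1) α + r` is positive
    have hkβ : (1 : ℝ) ≤ (((L₀ + 1) * β : ℕ) : ℝ) := by
      exact_mod_cast Nat.succ_le_of_lt (Nat.mul_pos (Nat.succ_pos L₀) hβ)
    have hr1 : (1 : ℝ) ≤ r := le_trans (by nlinarith [hkβ, hε1]) hr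
    have hr0 : r ≠ 0 := by
      rintro rfl
      norm_num at hr1
    obtain ⟨L', hL'⟩ : ∃ L', (L₀ + 1) * α + r = L' + 1 :=
      Nat.exists_eq_add_one_of_ne_zero (by omega)
    rw [hL'] at w1
    have hle : w ≤ (((L₀ + 1 : ℕ) : ℝ)) / ((L' : ℝ) + 1) := monRelativeExponent_le_div w1
    have hcast : (L' : ℝ) + 1 = ((L₀ : ℝ) + 1) * α + r := by
      have := congrArg (Nat.cast : ℕ → ℝ) hL'
      push_cast at this
      linarith
    rw [hcast] at hle
    have hD : (0 : ℝ) < ((L₀ : ℝ) + 1) * α + r := by positivity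
    have h1 : w * (((L₀ : ℝ) + 1) * α + r) ≤ (L₀ : ℝ) + 1 := by
      have := (le_div_iff₀ hD).1 hle
      push_cast at this
      exact this
    push_cast at hr
    have h2 : ((L₀ : ℝ) + 1) * ((α : ℝ) + (2 - ε) * β) ≤ ((L₀ : ℝ) + 1) * α + r := by
      have e : ((L₀ : ℝ) + 1) * ((α : ℝ) + (2 - ε) * β) =
          ((L₀ : ℝ) + 1) * α + (2 - ε) * (((L₀ : ℝ) + 1) * β) := by ring
      rw [e]
      linarith
    have h3 : ((L₀ : ℝ) + 1) * (w * ((α : ℝ) + (2 - ε) * β)) ≤ ((L₀ : ℝ) + 1) * 1 :=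
      calc ((L₀ : ℝ) + 1) * (w * ((α : ℝ) + (2 - ε) * β))
          = w * (((L₀ : ℝ) + 1) * ((α : ℝ) + (2 - ε) * β)) := by ring
        _ ≤ w * (((L₀ : ℝ) + 1) * α + r) := mul_le_mul_of_nonneg_left h2 hw0
        _ ≤ (L₀ : ℝ) + 1 := h1
        _ = ((L₀ : ℝ) + 1) * 1 := (mul_one _).symm
    exact le_of_mul_le_mul_left h3 (by positivity)
  -- Step 2: `ε → 0`.
  have hfin : w * ((α : ℝ) + 2 * β) ≤ 1 := by
    refine le_of_forall_pos_le_add fun δ hδ => ?_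
    set c : ℝ := w * β with hc
    have hc0 : 0 ≤ c := by
      rw [hc]
      exact mul_nonneg hw0 (Nat.cast_nonneg _)
    have hε : 0 < min 1 (δ / (c + 1)) := lt_min one_pos (div_pos hδ (by linarith))
    have h := step _ hε (min_le_left _ _)
    have hcε : c * min 1 (δ / (c + 1)) ≤ δ := by
      calc c * min 1 (δ / (c + 1)) ≤ c * (δ / (c + 1)) :=
            mul_le_mul_of_nonneg_left (min_le_right _ _) hc0
        _ ≤ δ := by
            rw [mul_div_assoc', div_le_iff₀ (by linarith : (0 : ℝ) < c + 1)]
            nlinarith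
    have hid : w * ((α : ℝ) + 2 * β) =
        w * ((α : ℝ) + (2 - min 1 (δ / (c + 1))) * β) + c * min 1 (δ / (c + 1)) := by
      rw [hc]
      ring
    rw [hid]
    linarith
  have hpos : (0 : ℝ) < (α : ℝ) + 2 * β := by positivity
  rw [le_div_iff₀ hpos]
  exact hfin

end SchoenhageTarget

/-! ## The theorem -/

section Main

/-- **CVZ 2021, Thm. 14, proved** (DISCHARGE of `CVZ2021_thm14`): for every tensor `t` not of the
form `u ⊗ v ⊗ w` with `t^{⊗m} ≥_M ⟨2,2,2⟩` for some `m`, and all `α, β ∈ ℕ`, `β > 0`,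
`2 i_M(t) + (α/β)(i_M(t) − 1) ≤ (ω(⟨2⟩,t) · ω_M(t, ⟨2⟩^{⊗α} ⊗ ⟨2,2,2⟩^{⊗β}) − α)/β`.
[cite: ChristandlVranaZuiddam2021, Thm. 14] -/
theorem CVZ2021_thm14_holds : CVZ2021_thm14 := by
  intro K _ ι κ μ _ _ _ t _ h0 α β hβ
  classical
  obtain ⟨m₀, hm₀⟩ := h0
  -- abbreviations for the four relative exponents
  set x : ℝ := relativeExponent (unitTensor K 2) t
  set y : ℝ := monRelativeExponent t (unitTensor K 2)
  set z : ℝ := monRelativeExponent t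
    (kroneckerTensor (kroneckerPow (unitTensor K 2) α) (kroneckerPow (matMulTensor K 2 2 2) β))
  set w : ℝ := monRelativeExponent
    (kroneckerTensor (kroneckerPow (unitTensor K 2) α) (kroneckerPow (matMulTensor K 2 2 2) β))
    (unitTensor K 2)
  -- witnesses: `t^{⊗(α m₀ + β m₀)} ≥_M s` and `s^{⊗1} ≥_M ⟨2⟩`
  have hU : TensorMonRestrictsTo (kroneckerPow t m₀) (unitTensor K 2) :=
    hm₀.trans (tensorMonRestrictsTo_matMulTensor_unitTensor_diag K 2)
  have hsw : TensorMonRestrictsTo (kroneckerPow t (α * m₀ + β * m₀))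
      (kroneckerTensor (kroneckerPow (unitTensor K 2) α)
        (kroneckerPow (matMulTensor K 2 2 2) β)) :=
    tensorMonRestrictsTo_pow_add_kronecker (tensorMonRestrictsTo_kroneckerPow_mul_of hU α)
      (tensorMonRestrictsTo_kroneckerPow_mul_of hm₀ β)
  have hsU : TensorMonRestrictsTo
      (kroneckerPow (kroneckerTensor (kroneckerPow (unitTensor K 2) α)
        (kroneckerPow (matMulTensor K 2 2 2) β)) 1) (unitTensor K 2) :=
    (tensorMonRestrictsTo_one_kroneckerPow _).trans
      (unitPow_kronecker_matMulPow_monRestrictsTo_unitTensor K α β (by omega))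
  -- triangle inequality (CVZ Prop. 7) and the value of the Schönhage target
  have htri : y ≤ z * w :=
    monRelativeExponent_triangle (exists_tensorMonRestrictsTo_pow_of_witness hsw)
      (exists_tensorMonRestrictsTo_pow_of_witness hsU)
  have hwle : w ≤ 1 / ((α : ℝ) + 2 * β) := monRelativeExponent_schoenhageTarget_unit_le K α β hβ
  have hx0 : 0 ≤ x := relativeExponent_nonneg _ _
  have hz0 : 0 ≤ z := monRelativeExponent_nonneg _ _
  have hpos : (0 : ℝ) < (α : ℝ) + 2 * β := by positivity
  have key : ((α : ℝ) + 2 * β) * y ≤ z := by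
    calc ((α : ℝ) + 2 * β) * y ≤ ((α : ℝ) + 2 * β) * (z * w) :=
          mul_le_mul_of_nonneg_left htri hpos.le
      _ ≤ ((α : ℝ) + 2 * β) * (z * (1 / ((α : ℝ) + 2 * β))) :=
          mul_le_mul_of_nonneg_left (mul_le_mul_of_nonneg_left hwle hz0) hpos.le
      _ = z := by
          rw [mul_left_comm, mul_one_div_cancel hpos.ne', mul_one]
  have hxz : ((α : ℝ) + 2 * β) * (x * y) ≤ x * z := by
    have := mul_le_mul_of_nonneg_left key hx0
    have e : ((α : ℝ) + 2 * β) * (x * y) = x * (((α : ℝ) + 2 * β) * y) := by ring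
    rw [e]
    exact this
  -- the printed form
  show 2 * (x * y) + (α / β : ℝ) * (x * y - 1) ≤ (x * z - α) / β
  have hβpos : (0 : ℝ) < β := by exact_mod_cast hβ
  have hβne : (β : ℝ) ≠ 0 := hβpos.ne'
  rw [le_div_iff₀ hβpos]
  have hid : (2 * (x * y) + (α / β : ℝ) * (x * y - 1)) * β = ((α : ℝ) + 2 * β) * (x * y) - α := by
    field_simp
    ring
  rw [hid]
  linarith

end Main

end Literature.Barriers.MatrixMultiplication

end
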